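import Summits.Ventures.HodgeRepro.Tier3EigenDictionary

/-!
# The pull-back dictionary: night-1's `pullLin (twistMap cls tw)` IS the eigen-coordinate form of the pull-back
`m^* : H¹(B_red) → H¹(B)` along the sum map — the «`pullLin (twistMap cls tw)` = `m^*`» line of
LEMMA-R-RESIDUE.md v10 §12 as a theorem

Blind re-derivation cell `pub-hodge-repro`, seat `t3-p4` (Tier 3, T3.5 for T3.4).  Target tree path
`lean/Summits/Ventures/HodgeRepro/Tier3PullbackDictionary.lean`; imports the cell's `Tier3EigenDictionary` (hence
`Tier3EigenBasis`, `Tier3WedgeChain`, `Tier3OrbitPullback` and night-1's `Night1ReducedPullback`: `pullLin`,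
`twistMap`, `coordVecOn`).

WHAT THIS FILE STATES.  The abstract side: `V_red = H¹(B_red, ℚ)` with its `K`-basis `ω : J → V_red` (one
generator per factor `A_j`, `K = F` the CM field), `V_B = H¹(B, ℚ)` with its `K`-basis `ω′ : ι → V_B`, the `i`-th
corner `A_{Φ(cls i) · tw i}` being the variety `A_{cls i}` with the CM structure TWISTED by `tw i`
(`a •′ v = (tw i)(a) • v`), and the pull-back of the sum map `m : B = ∏_i A_{T_i} → B_red = ∏_j A_j` on `H¹`: the
diagonal map `M (c • ω_j) = Σ_{cls i = j} (tw i)⁻¹(c) • ω′_i` (`F₀`-linear; the twist sits in the scalar).  Then: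

* `sum_tmul_inv_smul_eq_sum_mul_tmul_smul` — the TWISTED EIGENVECTOR IDENTITY
  `Σ_l x(k^*_l) ⊗ (τ⁻¹(k_l) • w) = Σ_l (x · τ)(k^*_l) ⊗ (k_l • w)` (expand `τ⁻¹(k_l)` in the basis `k`; the trace is
  Galois-invariant, `Algebra.trace_eq_of_algEquiv`): twisting the `V`-side by `τ⁻¹` twists the character by `τ`.
* `lTensor_pullback_eigenVec` — on the explicit eigenvectors of `Tier3EigenBasis`,
  `(1 ⊗ M) e (j, x) = Σ_{cls i = j} e′ (i, x · tw i)`: the `x`-eigenline of `A_j` is pulled back to the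
  `(x · tw i)`-eigenlines of the corners of class `j` — exactly night-1's `pullLin (twistMap cls tw)`
  (`e_{(j,x)} ↦ Σ_{(i,y) : (cls i, y (tw i)⁻¹) = (j,x)} e_{(i,y)}`).
* `exists_equivariant_eigenbasis_pullback` — the eigenbasis PAIR `e` of `K ⊗ V_red`, `e′` of `K ⊗ V_B`
  (Galois-equivariant, `K^J`- resp. `K^ι`-eigen as in `Tier3EigenDictionary`) with the pull-back relation.
* `filter_twistMap_eq_image`, **`map_baseChange_eq_pullLin_twistMap`** — ON THE MODEL: for the canonical
  eigen-coordinate identifications `Ψ : ℂ ⊗ H¹(B_red) ≃ ℂ^{J × Gal}`, `Ψ′ : ℂ ⊗ H¹(B) ≃ ℂ^{ι × Gal}` (`1 ⊗ e p ↦ e_p`;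
  `Tier3EigenDictionary.exists_eigenCoordinates`), `Ψ′ ∘ M_ℂ = pullLin (twistMap cls tw) ∘ Ψ`: the base change of
  the abstract pull-back IS night-1's pull-back, coefficient for coefficient.

HONESTY.  Linear algebra on Mathlib over the cell's own modules; no definition is introduced; nothing geometric is
built — that `M` is the pull-back of the sum map on `H¹` (S1 of LEMMA-R-RESIDUE.md §3: M2 Cor 5.6, M1
p0005:L38–L45, Künneth) and the twisted CM structure of a right-translated corner stay on paper / in print.
HC_CM is NOT proved by anyone in this repository.
-/

set_option autoImplicit false

open TensorProduct Finset

namespace HodgeRepro.Tier3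

open HodgeRepro.RouteC HodgeRepro.CMHodgeOn

variable {F₀ K : Type*} [Field F₀] [Field K] [Algebra F₀ K]

/-! ### §1 The twisted eigenvector identity -/

section Twist

variable {V : Type*} [AddCommGroup V] [Module K V] [Module F₀ V] [IsScalarTower F₀ K V]
variable {ι₀ : Type*} [Fintype ι₀] [DecidableEq ι₀]
variable [FiniteDimensional F₀ K] [Algebra.IsSeparable F₀ K]

omit [FiniteDimensional F₀ K] [Algebra.IsSeparable F₀ K] in
/-- The trace of `K/F₀` is invariant under the automorphisms of `K/F₀`. -/
theorem trace_algEquiv_apply (τ : K ≃ₐ[F₀] K) (a : K) : Algebra.trace F₀ K (τ a) = Algebra.trace F₀ K a :=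
  Algebra.trace_eq_of_algEquiv τ a

/-- The expansion of `a` in the trace-dual basis: `a = Σ_l Tr(a k_l) k^*_l`. -/
theorem sum_trace_mul_smul_traceDual (k : Module.Basis ι₀ F₀ K) (a : K) :
    ∑ l, Algebra.trace F₀ K (a * k l) • k.traceDual l = a := by
  conv_rhs => rw [← k.traceDual.sum_repr a]
  refine Finset.sum_congr rfl fun l _ => ?_
  rw [Module.Basis.traceDual_repr_apply, Algebra.traceForm_apply]

/-- **The twisted eigenvector identity**: twisting the `V`-side of the eigenvector `Σ_l x(k^*_l) ⊗ (k_l • w)` by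
`τ⁻¹` is the same as twisting its character by `τ`:
`Σ_l x(k^*_l) ⊗ (τ⁻¹(k_l) • w) = Σ_l (x * τ)(k^*_l) ⊗ (k_l • w)`
(expand `τ⁻¹(k_l)` in the basis `k`; the trace is Galois-invariant). -/
theorem sum_tmul_inv_smul_eq_sum_mul_tmul_smul (k : Module.Basis ι₀ F₀ K) (w : V) (x τ : K ≃ₐ[F₀] K) :
    ∑ l, x (k.traceDual l) ⊗ₜ[F₀] (τ⁻¹ (k l) • w) = ∑ l, (x * τ) (k.traceDual l) ⊗ₜ[F₀] (k l • w) := by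
  -- expand `τ⁻¹ (k l)` in the basis `k`
  have hexp : ∀ l, τ⁻¹ (k l) • w = ∑ m, Algebra.trace F₀ K (τ⁻¹ (k l) * k.traceDual m) • (k m • w) := by
    intro l
    conv_lhs => rw [← k.sum_repr (τ⁻¹ (k l))]
    rw [Finset.sum_smul]
    refine Finset.sum_congr rfl fun m _ => ?_
    rw [basis_repr_eq_trace_mul_traceDual, smul_assoc]
  simp only [hexp, TensorProduct.tmul_sum, TensorProduct.tmul_smul]
  rw [Finset.sum_comm]
  refine Finset.sum_congr rfl fun m _ => ?_
  simp only [TensorProduct.smul_tmul', ← TensorProduct.sum_tmul, ← map_smul, ← map_sum]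
  congr 1
  -- `Σ_l Tr(τ⁻¹(k_l) k^*_m) k^*_l = Σ_l Tr(τ(k^*_m) k_l) k^*_l = τ(k^*_m)`
  have htr : ∀ l, Algebra.trace F₀ K (τ⁻¹ (k l) * k.traceDual m) =
      Algebra.trace F₀ K (τ (k.traceDual m) * k l) := by
    intro l
    rw [← trace_algEquiv_apply τ, map_mul, AlgEquiv.aut_inv, AlgEquiv.apply_symm_apply, mul_comm]
  rw [AlgEquiv.mul_apply]
  congr 1
  rw [← sum_trace_mul_smul_traceDual k (τ (k.traceDual m))]
  refine Finset.sum_congr rfl fun l _ => ?_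
  rw [htr]

end Twist

/-! ### §2 The pull-back on the eigenbasis: `(1 ⊗ M) e (j, x) = Σ_{cls i = j} e′ (i, x · tw i)` -/

section Pullback

variable {Vr VB : Type*} [AddCommGroup Vr] [Module K Vr] [Module F₀ Vr] [IsScalarTower F₀ K Vr]
  [AddCommGroup VB] [Module K VB] [Module F₀ VB] [IsScalarTower F₀ K VB]
variable {ι₀ : Type*} [Fintype ι₀] [DecidableEq ι₀]
variable {J ι : Type*} [Fintype ι] [DecidableEq J]
variable [FiniteDimensional F₀ K] [Algebra.IsSeparable F₀ K]

omit [IsScalarTower F₀ K Vr] in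
/-- **The pull-back on the explicit eigenvectors.**  For `M : V_red → V_B` (`F₀`-linear) with
`M (c • ω_j) = Σ_{cls i = j} (tw i)⁻¹(c) • ω′_i` — the diagonal map `H¹(B_red) → H¹(B)` of the sum map, the
`i`-th corner carrying the CM structure twisted by `tw i` — the eigenvector `e (j, x) = Σ_l x(k^*_l) ⊗ (k_l • ω_j)`
is carried to the sum of the eigenvectors `e′ (i, x · tw i)` over the corners `i` of the class `j`:
night-1's `pullLin (twistMap cls tw)` (`e_{(j,x)} ↦ Σ_{cls i = j} e_{(i, x · tw i)}`) on the abstract side. -/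
theorem lTensor_pullback_eigenVec (k : Module.Basis ι₀ F₀ K) (ω : J → Vr) (ω' : ι → VB)
    (cls : ι → J) (tw : ι → K ≃ₐ[F₀] K) (M : Vr →ₗ[F₀] VB)
    (hM : ∀ (c : K) (j : J), M (c • ω j) = ∑ i ∈ univ.filter (fun i => cls i = j), ((tw i)⁻¹ c) • ω' i)
    (x : K ≃ₐ[F₀] K) (j : J) :
    LinearMap.lTensor K M (∑ l, x (k.traceDual l) ⊗ₜ[F₀] (k l • ω j)) =
      ∑ i ∈ univ.filter (fun i => cls i = j), ∑ l, (x * tw i) (k.traceDual l) ⊗ₜ[F₀] (k l • ω' i) := by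
  simp only [map_sum, LinearMap.lTensor_tmul, hM, TensorProduct.tmul_sum]
  rw [Finset.sum_comm]
  refine Finset.sum_congr rfl fun i _ => ?_
  exact sum_tmul_inv_smul_eq_sum_mul_tmul_smul k (ω' i) x (tw i)

variable [IsGalois F₀ K]

/-- **The eigenbasis pair of `H¹(B_red)` and `H¹(B)` with the pull-back relation.**  For `K`-bases `ω : J → V_red`
and `ω′ : ι → V_B`, diagonal actions `A`, `A′` of `K^J`, `K^ι` on them, and `M` as in
`lTensor_pullback_eigenVec`, there are Galois-equivariant eigenbases `e` of `K ⊗ V_red` and `e′` of `K ⊗ V_B`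
(`Tier3EigenBasis` / `Tier3EigenDictionary`: `(σ ⊗ 1) e (j, x) = e (j, σ x)`, `(1 ⊗ A b) e (j, x) = x (b j) • e (j, x)`,
likewise for `e′`) with `(1 ⊗ M) e (j, x) = Σ_{cls i = j} e′ (i, x · tw i)`. -/
theorem exists_equivariant_eigenbasis_pullback [Fintype J] (ω : Module.Basis J K Vr) (ω' : Module.Basis ι K VB)
    (A : (J → K) → Vr →ₗ[K] Vr) (hA : ∀ (b : J → K) (j : J), A b (ω j) = b j • ω j)
    (A' : (ι → K) → VB →ₗ[K] VB) (hA' : ∀ (b : ι → K) (i : ι), A' b (ω' i) = b i • ω' i)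
    (cls : ι → J) (tw : ι → K ≃ₐ[F₀] K) (M : Vr →ₗ[F₀] VB)
    (hM : ∀ (c : K) (j : J), M (c • ω j) = ∑ i ∈ univ.filter (fun i => cls i = j), ((tw i)⁻¹ c) • ω' i) :
    ∃ (e : Module.Basis (J × (K ≃ₐ[F₀] K)) K (K ⊗[F₀] Vr))
      (e' : Module.Basis (ι × (K ≃ₐ[F₀] K)) K (K ⊗[F₀] VB)),
      (∀ (σ x : K ≃ₐ[F₀] K) (j : J), LinearMap.rTensor Vr σ.toLinearMap (e (j, x)) = e (j, σ * x)) ∧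
      (∀ (x : K ≃ₐ[F₀] K) (j : J) (b : J → K),
        LinearMap.lTensor K ((A b).restrictScalars F₀) (e (j, x)) = x (b j) • e (j, x)) ∧
      (∀ (σ x : K ≃ₐ[F₀] K) (i : ι), LinearMap.rTensor VB σ.toLinearMap (e' (i, x)) = e' (i, σ * x)) ∧
      (∀ (x : K ≃ₐ[F₀] K) (i : ι) (b : ι → K),
        LinearMap.lTensor K ((A' b).restrictScalars F₀) (e' (i, x)) = x (b i) • e' (i, x)) ∧
      ∀ (x : K ≃ₐ[F₀] K) (j : J),
        LinearMap.lTensor K M (e (j, x)) = ∑ i ∈ univ.filter (fun i => cls i = j), e' (i, x * tw i) := by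
  classical
  let k := Module.finBasis F₀ K
  haveI : FiniteDimensional K (K ⊗[F₀] Vr) :=
    Module.Finite.of_basis (Algebra.TensorProduct.basis K (k.smulTower ω) : Module.Basis (_ × J) K (K ⊗[F₀] Vr))
  haveI : FiniteDimensional K (K ⊗[F₀] VB) :=
    Module.Finite.of_basis (Algebra.TensorProduct.basis K (k.smulTower ω') : Module.Basis (_ × ι) K (K ⊗[F₀] VB))
  refine ⟨basisOfLinearIndependentOfCardEqFinrank' _ (linearIndependent_eigenVec k ω)
      (card_prod_algEquiv_eq_finrank k ω),
    basisOfLinearIndependentOfCardEqFinrank' _ (linearIndependent_eigenVec k ω')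
      (card_prod_algEquiv_eq_finrank k ω'), ?_, ?_, ?_, ?_, ?_⟩
  · intro σ x j
    simp only [coe_basisOfLinearIndependentOfCardEqFinrank']
    exact rTensor_eigenVec k ω σ x j
  · intro x j b
    simp only [coe_basisOfLinearIndependentOfCardEqFinrank']
    exact lTensor_diag_eigenVec k ω A hA x j b
  · intro σ x i
    simp only [coe_basisOfLinearIndependentOfCardEqFinrank']
    exact rTensor_eigenVec k ω' σ x i
  · intro x i b
    simp only [coe_basisOfLinearIndependentOfCardEqFinrank']
    exact lTensor_diag_eigenVec k ω' A' hA' x i b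
  · intro x j
    simp only [coe_basisOfLinearIndependentOfCardEqFinrank']
    exact lTensor_pullback_eigenVec k ω ω' cls tw M hM x j

end Pullback

/-! ### §3 On the model: the pull-back in eigen-coordinates IS night-1's `pullLin (twistMap cls tw)` -/

section Model

variable {Vr VB : Type*} [AddCommGroup Vr] [Module K Vr] [Module F₀ Vr] [IsScalarTower F₀ K Vr]
  [AddCommGroup VB] [Module K VB] [Module F₀ VB] [IsScalarTower F₀ K VB]
variable {J ι : Type*} [Fintype ι] [DecidableEq J] [DecidableEq ι] [DecidableEq (K ≃ₐ[F₀] K)]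
variable [Algebra K ℂ] [FiniteDimensional F₀ K]

omit [Algebra K ℂ] in
/-- The fibre of night-1's twist map over `(j, x)` is `{(i, x · tw i) : cls i = j}`. -/
theorem filter_twistMap_eq_image (cls : ι → J) (tw : ι → K ≃ₐ[F₀] K) (j : J) (x : K ≃ₐ[F₀] K) :
    (univ.filter fun p : ι × (K ≃ₐ[F₀] K) => twistMap cls tw p = (j, x)) =
      (univ.filter fun i => cls i = j).image (fun i => (i, x * tw i)) := by
  ext ⟨i, y⟩
  simp only [mem_filter, mem_univ, true_and, mem_image, twistMap_apply, Prod.mk.injEq]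
  constructor
  · rintro ⟨rfl, rfl⟩
    exact ⟨i, rfl, rfl, by rw [inv_mul_cancel_right]⟩
  · rintro ⟨i', hi', rfl, rfl⟩
    exact ⟨hi', by rw [mul_inv_cancel_right]⟩

omit [Module K Vr] [IsScalarTower F₀ K Vr] [Module K VB] [IsScalarTower F₀ K VB] in
/-- **The pull-back in eigen-coordinates IS `pullLin (twistMap cls tw)`.**  For the canonical eigen-coordinate
identifications `Ψ` of `ℂ ⊗ H¹(B_red)` and `Ψ′` of `ℂ ⊗ H¹(B)` (`1 ⊗ e p ↦ e_p`, `1 ⊗ e′ p ↦ e_p`;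
`Tier3EigenDictionary.exists_eigenCoordinates`) and eigenbases related by the pull-back relation of
`exists_equivariant_eigenbasis_pullback`, the base change of `M` to `ℂ` is, in coordinates, night-1's
`pullLin (twistMap cls tw)`: `Ψ′ ∘ M_ℂ = pullLin (twistMap cls tw) ∘ Ψ`. -/
theorem map_baseChange_eq_pullLin_twistMap (cls : ι → J) (tw : ι → K ≃ₐ[F₀] K) (M : Vr →ₗ[F₀] VB)
    (e : Module.Basis (J × (K ≃ₐ[F₀] K)) K (K ⊗[F₀] Vr))
    (e' : ι × (K ≃ₐ[F₀] K) → K ⊗[F₀] VB)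
    (hMe : ∀ (x : K ≃ₐ[F₀] K) (j : J),
      LinearMap.lTensor K M (e (j, x)) = ∑ i ∈ univ.filter (fun i => cls i = j), e' (i, x * tw i))
    (Ψ : ℂ ⊗[K] (K ⊗[F₀] Vr) ≃ₗ[ℂ] (J × (K ≃ₐ[F₀] K) → ℂ))
    (hΨ : ∀ p, Ψ ((1 : ℂ) ⊗ₜ[K] e p) = coordVecOn p)
    (Ψ' : ℂ ⊗[K] (K ⊗[F₀] VB) ≃ₗ[ℂ] (ι × (K ≃ₐ[F₀] K) → ℂ))
    (hΨ' : ∀ p, Ψ' ((1 : ℂ) ⊗ₜ[K] e' p) = coordVecOn p) (z : ℂ ⊗[K] (K ⊗[F₀] Vr)) :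
    Ψ' (LinearMap.baseChange ℂ (LinearMap.baseChange K M) z) = pullLin (twistMap cls tw) (Ψ z) := by
  have hext : (Ψ' : ℂ ⊗[K] (K ⊗[F₀] VB) →ₗ[ℂ] (ι × (K ≃ₐ[F₀] K) → ℂ)) ∘ₗ
        LinearMap.baseChange ℂ (LinearMap.baseChange K M) =
      pullLin (twistMap cls tw) ∘ₗ (Ψ : ℂ ⊗[K] (K ⊗[F₀] Vr) →ₗ[ℂ] (J × (K ≃ₐ[F₀] K) → ℂ)) := by
    refine (e.baseChange ℂ).ext fun p => ?_
    obtain ⟨j, x⟩ := p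
    rw [LinearMap.comp_apply, LinearMap.comp_apply, LinearEquiv.coe_coe, LinearEquiv.coe_coe,
      Module.Basis.baseChange_apply, LinearMap.baseChange_tmul, LinearMap.baseChange_eq_ltensor, hMe,
      TensorProduct.tmul_sum, map_sum, hΨ, pullLin_coordVecOn, filter_twistMap_eq_image,
      Finset.sum_image (fun i _ i' _ h => (Prod.mk.inj h).1)]
    exact Finset.sum_congr rfl fun i _ => hΨ' (i, x * tw i)
  exact LinearMap.congr_fun hext z

end Model

end HodgeRepro.Tier3
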